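import Summits.BirchSwinnertonDyer.Rank1Residual.Additive.XGordCyclotomicThreeLowerX3Facts
import Summits.BirchSwinnertonDyer.Rank1Residual.Additive.XGordRankZeroCyclotomicThreeLowerFacts
import Summits.BirchSwinnertonDyer.Rank1Residual.Additive.XGordRankZeroOneCyclotomicThreeLowerFacts
import Literature.NumberTheory.EllipticCurves.Rank1Residual.Typed.JointLower
import HarnessLib

/-!
# The `K`-side LOWER twins at `p = 3` in the cell's pair currency `Typed.JointLowerBoundAt`
# (lead ruling R5-11 (ii) / route planner 3: state the conclusion in the landed currency p252148 and
# take `MissingLowerBoundAt` through `missingLowerBoundAt_of_joint_of_upper`)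
# (cell `b2b-bsdres`, team n1011, seat p16 GEN 2, OWNERS row T-N11-GK3LOW)

HONEST FRAMING (cell `b2b-bsdres`, run/shared/lean/b2b/bsd-rank1-residual/, verbatim in every
file): the goal of the cell is to DELETE the COMBINATION-SHAPED residual classes of the
Birch–Swinnerton-Dyer formula for ALL analytic-rank `≤ 1` elliptic curves over `ℚ` — "full BSD
formula for every rank `≤ 1` curve in class `C`" assembled STRICTLY from published theorems — so
that the rank-`≤ 1` remainder becomes exactly the CONSTRUCTION-SHAPED classes, which are TYPED
(missing-input `Prop`s), NOT attempted. This is not "finishing BSD". Team n1011 (N10 / N11), seat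
p16: research route; the labels of X3 / X4 / X1 / X10 and the N10 / N11 marks are UNCHANGED by this
file; nothing is booked here.

Theorems only (no `def`, no `sorry`, no new named fact). The conclusion
`∃ q_V q_W, Ш_an(V) = q_V ∧ Ш_an(W) = q_W ∧ ord₃ q_V + ord₃ q_W ≤ ord₃ #Ш(V) + ord₃ #Ш(W)` of the four
LOWER-twin files of row T-N11-GK3LOW (`XGordRankZeroCyclotomicThreeLower[Facts]`, ranks `(0,0)`;
`XGordRankZeroOneCyclotomicThreeLower[Facts]`, ranks `(0,1)`; `XGordCyclotomicThreeLowerX3Facts`, X3)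
IS, letter for letter, the tree's pair currency `Typed.JointLowerBoundAt V W 3`
(`Literature/…/Rank1Residual/Typed/JointLower.lean`, p252148 — "the currency in which every theorem
over an imaginary quadratic `K` pays out"). This file records the identification (`Iff.rfl`-level
repackaging), as asked by the lead (R5-11 (ii)) and by route planner 3 (GEN 4); the single-curve
LOWER halves already landed (`….missingLowerBoundAt_of_missingUpperBoundAt_twist_of_surj_of_ram`,
`….missingLowerBoundAt_of_missingUpperBoundAt_twist_of_facts`) ARE the currency's bookkeeping lemma
`missingLowerBoundAt_partner_of_joint_of_upper` applied to these joint forms (same statements; not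
restated here — dedup), and `missingPPartAt_and_of_joint_of_upper_of_upper` is instantiated once.

RELATION TO THE OTHER `K = ℚ(√−3)` NODES OF THE CELL (one sentence each, BY NAME): the input (⊇/K)
of these files is the CYCLOTOMIC two-branch main-conjecture containment for `V` over the cyclotomic
`ℤ₃`-extension `K_∞ = ℚ(ζ_{3^∞})` of `K = ℚ(ζ₃)` — NOT the anticyclotomic line: it is orthogonal to,
and neither implies nor is implied by, the typed inputs `Route3Anticyc.DefiniteInputAt` /
`Route3Anticyc.HeegnerInputAt` of `Additive/AnticycJointLower.lean` (p252389, seat p10 / planner r3,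
Heegner field with `p` split), whose consumers pay out in the SAME currency `JointLowerBoundAt`; and it
is the `K`-side (base-changed curve `V_K`, `(V.baseChange K).SelmerDualData`) form of the wall whose
ℚ-side `χ_K`-COMPONENT form is p10's `QuadraticBranchLowerDivisibilityAt V 3`
(`Additive/QuadraticBranchLower.lean`) — the two are not bridged in the tree (the Λ-adic
decomposition `X(V_K/K_∞) ≅ X(V/ℚ_∞) ⊕ X(W/ℚ_∞)` across the K-side / ℚ-side Selmer models is the
located follow-up of row T-N11-GK3LOW, not attempted).
-/

noncomputable section

open scoped Classical MatrixGroups ModularForm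

open CongruenceSubgroup WeierstrassCurve NumberField IsDedekindDomain
  Literature.NumberTheory.EllipticCurves Literature.NumberTheory.EllipticCurves.ModularForms
  Literature.NumberTheory.EllipticCurves.Rank1Residual
  Literature.NumberTheory.EllipticCurves.Rank1Residual.Typed
  Literature.NumberTheory.GaloisRepresentations

namespace Summit.BirchSwinnertonDyer.Rank1Residual.Additive

section Joint

variable (V : WeierstrassCurve ℚ) [V.IsElliptic] [V.IsGloballyMinimal]
  (W : WeierstrassCurve ℚ) [W.IsElliptic] [W.IsGloballyMinimal]

/- The ONE residual input (⊇/K) for `V` over `K = CyclotomicField 3 ℚ`; shared section hypothesis. -/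
variable
    (hLowK : ∀ {κ : ZpExtension (CyclotomicField 3 ℚ) 3}
      {γ : Field.absoluteGaloisGroup (CyclotomicField 3 ℚ)} {N : ℕ} [NeZero N]
      {f : CuspForm (Gamma0 N) 2},
      κ.IsCyclotomic → κ.IsTopGenerator γ →
      (∃ ζ : ℤ_[3]ˣ, IsOfFinOrder ζ ∧
        ((GaloisRep.cyclotomicCharacter (CyclotomicField 3 ℚ) 3 γ * ζ : ℤ_[3]ˣ) : ℤ_[3]) =
          (cyclotomicGenerator 3 : ℤ_[3])) →
      IsNewformOf V f →
      ∀ (D : (V.baseChange (CyclotomicField 3 ℚ)).SelmerDualData κ γ) (ϖ ϖ' : ℚ),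
        (ϖ : ℝ) * V.realPeriodRat = plusPeriod f →
        (ϖ' : ℝ) * V.imaginaryPeriodRat = minusPeriod f →
        ∀ g ∈ D.charIdeal, ∃ h : IwasawaAlgebra 3,
          iwasawaToPowerSeries 3 g =
            iwasawaToPowerSeries 3 h *
              (PowerSeries.C ((ϖ : ℚ_[3]) * (ϖ' : ℚ_[3])) *
                (padicLFunction f ((unitRoot V 3 : ℤ_[3]) : ℚ_[3]) *
                  padicLFunctionMinusBranch f ((unitRoot V 3 : ℤ_[3]) : ℚ_[3]) 1)))

include hLowK

/-- **X4, ranks `(0,0)`: `JointLowerBoundAt V W 3`** (the pair currency p252148) for the good ordinary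
`V` and its additive twist `W = C • V^{(−3)}` with `surj(3) ∧ ram(3)`, from (⊇/K) + named facts —
`XGordCyclotomicThreeLower.exists_padicVal_shaAn_add_le_of_surj_of_ram` repackaged. Anomalous rows included.
[cite: GreenbergLNM1716, Thm. 4.1 (p. 102)] [cite: Miller2011LMS, Def. 1.1] -/
theorem XGordCyclotomicThreeLower.jointLowerBoundAt_of_surj_of_ram
    (hKato : Kato2004.charIdeal_dvd_padicLFunction_cyclotomicThree_of_surjective)
    (hGr : Greenberg1999.thm41_charValue_rankZero_numberField)
    (hMilne : Milne1972.bsdQuotient_baseChange_quadratic_anyModel)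
    (hGZK : rank_eq_analyticRank_of_analyticRank_le_one) (hmod : hasEntireLFunction_rat)
    (hmodD : nonempty_modularParametrizationData)
    (C : VariableChange ℚ) (hC : C • V.quadraticTwist (-(3 : ℚ)) = W)
    (hord : IsOrdinaryAt V 3) (hsurj : Surj W 3) (hram : Ram W 3)
    (hadd : Addv W 3) (hrV : V.analyticRank = 0) (hrW : W.analyticRank = 0) :
    JointLowerBoundAt V W 3 :=
  XGordCyclotomicThreeLower.exists_padicVal_shaAn_add_le_of_surj_of_ram V W hLowK hKato hGr hMilne hGZK hmod hmodD C hC hord hsurj hram hadd hrV hrW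

/-- **X4, ranks `(0,0)`: both `MissingPPartAt`s from the joint lower half and BOTH upper halves**
(`missingPPartAt_and_of_joint_of_upper_of_upper`). [cite: Miller2011LMS, Def. 1.1] -/
theorem XGordCyclotomicThreeLower.missingPPartAt_and_of_upper_of_upper_twist
    (hKato : Kato2004.charIdeal_dvd_padicLFunction_cyclotomicThree_of_surjective)
    (hGr : Greenberg1999.thm41_charValue_rankZero_numberField)
    (hMilne : Milne1972.bsdQuotient_baseChange_quadratic_anyModel)
    (hGZK : rank_eq_analyticRank_of_analyticRank_le_one) (hmod : hasEntireLFunction_rat)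
    (hmodD : nonempty_modularParametrizationData)
    (C : VariableChange ℚ) (hC : C • V.quadraticTwist (-(3 : ℚ)) = W)
    (hord : IsOrdinaryAt V 3) (hsurj : Surj W 3) (hram : Ram W 3)
    (hadd : Addv W 3) (hrV : V.analyticRank = 0) (hrW : W.analyticRank = 0)
    (huV : MissingUpperBoundAt V 3) (huW : MissingUpperBoundAt W 3) :
    MissingPPartAt V 3 ∧ MissingPPartAt W 3 :=
  missingPPartAt_and_of_joint_of_upper_of_upper
    (XGordCyclotomicThreeLower.jointLowerBoundAt_of_surj_of_ram V W hLowK hKato hGr hMilne hGZK hmod hmodD C hC hord hsurj hram hadd hrV hrW) huV huW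

/-- **X4, ranks `(0,1)` (twist of analytic rank ONE, certificate `[T¹]L₃ ≠ 0`): `JointLowerBoundAt V W 3`**
— `XGordRankZeroOneCyclotomicThreeLower.exists_padicVal_shaAn_add_le_of_surj_of_ram` repackaged.
[cite: GreenbergLNM1716, §4 p. 110] [cite: Miller2011LMS, Def. 1.1] -/
theorem XGordRankZeroOneCyclotomicThreeLower.jointLowerBoundAt_of_surj_of_ram
    (hKato : Kato2004.charIdeal_dvd_padicLFunction_cyclotomicThree_of_surjective)
    (hS1 : Greenberg1999.schneider_charCoeff_rankOne_quadraticBaseChange)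
    (hPR : perrinRiou_rankOne_leadingTerms_odd) (hMT : mazur_tate_sigma_exists_odd)
    (hMilne : Milne1972.bsdQuotient_baseChange_quadratic_anyModel)
    (hGZK : rank_eq_analyticRank_of_analyticRank_le_one) (hmod : hasEntireLFunction_rat)
    (hmodD : nonempty_modularParametrizationData)
    (C : VariableChange ℚ) (hC : C • V.quadraticTwist (-(3 : ℚ)) = W)
    (hord : IsOrdinaryAt V 3) (hsurj : Surj W 3) (hram : Ram W 3) (hadd : Addv W 3)
    (hrV : V.analyticRank = 1) (hrW : W.analyticRank = 0)
    (hcert : ∀ {N : ℕ} [NeZero N] (f : CuspForm (Gamma0 N) 2), IsNewformOf V f →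
      PowerSeries.coeff 1 (padicLFunction f ((unitRoot V 3 : ℤ_[3]) : ℚ_[3])) ≠ 0) :
    JointLowerBoundAt V W 3 :=
  XGordRankZeroOneCyclotomicThreeLower.exists_padicVal_shaAn_add_le_of_surj_of_ram V W hLowK hKato hS1 hPR hMT hMilne hGZK hmod hmodD C hC hord hsurj hram hadd hrV hrW hcert

/-- **X3, ranks `(0,0)` (reducible `V[3]`, Wuthrich torsion): `JointLowerBoundAt V W 3`** —
`X3CyclotomicThreeLower.exists_padicVal_shaAn_add_le_of_facts` repackaged.
[cite: Wuthrich2014, Thm. 16 (p. 397)] [cite: Miller2011LMS, Def. 1.1] -/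
theorem X3CyclotomicThreeLower.jointLowerBoundAt_of_facts
    (hW16 : Wuthrich2014.charIdeal_dvd_padicLFunction_cyclotomicThree)
    (hGr : Greenberg1999.thm41_charValue_rankZero_numberField)
    (hMilne : Milne1972.bsdQuotient_baseChange_quadratic_anyModel)
    (hGZK : rank_eq_analyticRank_of_analyticRank_le_one) (hmod : hasEntireLFunction_rat)
    (hmodD : nonempty_modularParametrizationData)
    (C : VariableChange ℚ) (hC : C • V.quadraticTwist (-(3 : ℚ)) = W)
    (hord : IsOrdinaryAt V 3) (hred : ¬ V.HasIrreducibleModPGaloisRep 3) (hadd : Addv W 3)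
    (hrV : V.analyticRank = 0) (hrW : W.analyticRank = 0) :
    JointLowerBoundAt V W 3 :=
  X3CyclotomicThreeLower.exists_padicVal_shaAn_add_le_of_facts V W hLowK hW16 hGr hMilne hGZK hmod hmodD C hC hord hred hadd hrV hrW

/-- **X3, ranks `(0,1)`: `JointLowerBoundAt V W 3`** —
`X3GordRankZeroOneCyclotomicThreeLower.exists_padicVal_shaAn_add_le_of_facts` repackaged.
[cite: Wuthrich2014, Thm. 16 (p. 397)] [cite: Miller2011LMS, Def. 1.1] -/
theorem X3GordRankZeroOneCyclotomicThreeLower.jointLowerBoundAt_of_facts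
    (hW16 : Wuthrich2014.charIdeal_dvd_padicLFunction_cyclotomicThree)
    (hS1 : Greenberg1999.schneider_charCoeff_rankOne_quadraticBaseChange)
    (hPR : perrinRiou_rankOne_leadingTerms_odd) (hMT : mazur_tate_sigma_exists_odd)
    (hMilne : Milne1972.bsdQuotient_baseChange_quadratic_anyModel)
    (hGZK : rank_eq_analyticRank_of_analyticRank_le_one) (hmod : hasEntireLFunction_rat)
    (hmodD : nonempty_modularParametrizationData)
    (C : VariableChange ℚ) (hC : C • V.quadraticTwist (-(3 : ℚ)) = W)
    (hord : IsOrdinaryAt V 3) (hred : ¬ V.HasIrreducibleModPGaloisRep 3) (hadd : Addv W 3)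
    (hrV : V.analyticRank = 1) (hrW : W.analyticRank = 0)
    (hcert : ∀ {N : ℕ} [NeZero N] (f : CuspForm (Gamma0 N) 2), IsNewformOf V f →
      PowerSeries.coeff 1 (padicLFunction f ((unitRoot V 3 : ℤ_[3]) : ℚ_[3])) ≠ 0) :
    JointLowerBoundAt V W 3 :=
  X3GordRankZeroOneCyclotomicThreeLower.exists_padicVal_shaAn_add_le_of_facts V W hLowK hW16 hS1 hPR hMT hMilne hGZK hmod hmodD C hC hord hred hadd hrV hrW hcert

end Joint

end Summit.BirchSwinnertonDyer.Rank1Residual.Additive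

end
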